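import Literature.RepresentationTheory.HeisenbergGroup.SchrodingerLeraySectionGram
import Literature.RepresentationTheory.HeisenbergGroup.DoubledDeltaSymplecticTransport
import Literature.RepresentationTheory.HeisenbergGroup.ImplementerIntertwinerTransport
import Literature.NumberTheory.Automorphic.RankOneFiniteAdeleWeil
import Mathlib.LinearAlgebra.InvariantBasisNumber
import HarnessLib

/-!
# Transport of the Schrödinger model along a symplectic isomorphism: `(F^n × F^n, A_T) ≃ (F^ι × F^ι, A_1)`

Topic `RepresentationTheory/HeisenbergGroup`; namespace `Literature.RepresentationTheory.HeisenbergGroup`.  KERNEL ONLY: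
theorems; no definition, no named fact, no `sorry`.

Setting: `F` a non-archimedean local field with `2` invertible, `ψ` a continuous non-trivial character, finite index
types `n`, `ι`, a Gram matrix `T ∈ M_n(F)` with `det T` a unit; the smooth Schrödinger models
`ρ₁ = schrodingerSB ⟨·, T ·⟩ ψ` on `𝒮(F^n)` (duality `β_T = Matrix.toLinearMap₂' F T`) and
`ρ₂ = schrodingerSB ⟨·, ·⟩ ψ` on `𝒮(F^ι)` (the «dot model», `dotProductBilin F F`); a linear isomorphism
`Γ : F^n × F^n ≃ F^ι × F^ι` carrying Weil's alternating form `A_T = alt (polar β_T)` to `A_1 = alt (polar ⟨·,·⟩)`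
(hypothesis `hΓ`).

* (a) `exists_heisenbergEquiv_of_symplectic` — there is an isomorphism of Heisenberg groups
  `Φ : Heisenberg (polar β_T) ≃* Heisenberg (polar ⟨·,·⟩)`, **`Φ (w, t) = (Γ w, t + ½ (⟨Γ w|Γ w⟩ − β_T(w|w)))`**
  (polar forms) — the tree's `Heisenberg.conjCoboundaryEquiv Γ` of `DoubledDeltaSymplecticTransport` (stated for any
  commutative ring and any pair of bilinear forms with `Γ` matching their alternating parts).
* (b) **`exists_intertwiner_of_symplectic`** — for ANY map `Φ` with that formula there is a linear isomorphism
  `Ψ : 𝒮(F^n) ≃ₗ[ℂ] 𝒮(F^ι)` with **`Ψ (ρ₁(h) f) = ρ₂(Φ h) (Ψ f)`**.  Proof: `|n| = |ι|` (`Γ` is an isomorphism), so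
  pick `e : n ≃ ι`; the isomorphism `e₀ = (relabel by e) ∘ (x, y) ↦ (x, T y)` carries `polar β_T` to `polar ⟨·,·⟩`
  EXACTLY and is implemented by the explicit operator `f ↦ f ∘ (· ∘ e)` (the tree's `schrodingerSB_gram_eq` and a
  relabelling of coordinates); `g = e₀⁻¹ Γ ∈ Sp(A_T)` is implemented on `ρ₁` by the tree's
  `existsImplementer_schrodingerSB_gram` ([MoeglinVignerasWaldspurger1987] Chap. 2 II.1 (A), II.6); `Ψ` is the composite,
  and Weil's quadratic correction of `ofSymplectic g` is exactly the `½`-term of `Φ`.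
* (c) **`implements_conj_of_symplectic`** — for any such `Φ` and any intertwiner `Ψ` as in (b): if `M` implements
  `ofSymplectic g` on `ρ₁` then `Ψ⁻¹ M Ψ` (`Ψ.symm ≪≫ₗ M ≪≫ₗ Ψ`) implements `ofSymplectic (Γ g Γ⁻¹)`
  (`symplecticConjOfAlt Γ _ g`) on `ρ₂` — `ImplementerIntertwinerTransport.Implements.intertwinerConj` and the
  compatibility `Heisenberg.conjCoboundaryEquiv_ofSymplectic_act` (any commutative ring, any models `ρ₁`, `ρ₂`).

This is [MoeglinVignerasWaldspurger1987] Chap. 2 II.1–II.2: «`S̃p_ψ(W)` … à isomorphisme près, il est indépendant de la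
réalisation de `ρ_ψ`», made explicit for the two realisations `ρ₁`, `ρ₂` and a symplectic change of coordinates `Γ`.
Written for the cell `hodgecm-mathlib` (fan B, rung B-IV; node (H-C) of the second token «Heisenberg-parabolic
Kirillov» on `mvw_IV4_rankOne_irreducibleOrZero`: `Γ` is the adapted symplectic chart of an isotropic line).  Nothing
about theta lifts is asserted here.

## References
* [MoeglinVignerasWaldspurger1987] C. Mœglin, M.-F. Vignéras, J.-L. Waldspurger, LNM 1291 (1987), Chap. 2 I.4, I.7,
  II.1 (A)–(B), II.6.
* [Weil1964] A. Weil, Acta Math. 111 (1964), n° 5, n° 34.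
-/

set_option autoImplicit false

noncomputable section

namespace Literature.RepresentationTheory.HeisenbergGroup

open _root_.Matrix
open Literature.NumberTheory.Automorphic

/-! ## (a) and (c): any commutative ring, any pair of bilinear forms with matching alternating parts -/

section General

variable {R : Type*} [CommRing R] {V V' : Type*} [AddCommGroup V] [Module R V]
  [AddCommGroup V'] [Module R V'] {B : V →ₗ[R] V →ₗ[R] R} {B' : V' →ₗ[R] V' →ₗ[R] R}
  (Γ : V ≃ₗ[R] V') (hΓ : ∀ w w' : V, alt B' (Γ w) (Γ w') = alt B w w')

include hΓ in
/-- the hypothesis `A'(Γ w, Γ w') = A(w, w')` unfolded. [cite: Weil1964, n° 5, p. 150] -/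
theorem sub_eq_sub_of_alt_eq (v w : V) : B' (Γ v) (Γ w) - B' (Γ w) (Γ v) = B v w - B w v := by
  simpa only [alt_apply] using hΓ v w

variable [Invertible (2 : R)]

include hΓ in
/-- **(a) the Heisenberg isomorphism of a symplectic linear isomorphism**: `Φ (w, t) = (Γ w, t + ½(B'(Γw, Γw) − B(w, w)))`
— the tree's `Heisenberg.conjCoboundaryEquiv Γ`. [cite: MoeglinVignerasWaldspurger1987, Chap. 2 I.7] -/
theorem exists_heisenbergEquiv_of_symplectic :
    ∃ Φ : Heisenberg B ≃* Heisenberg B',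
      ∀ (w : V) (t : R), Φ ⟨w, t⟩ = ⟨Γ w, t + ⅟(2 : R) * (B' (Γ w) (Γ w) - B w w)⟩ :=
  ⟨Heisenberg.conjCoboundaryEquiv Γ (sub_eq_sub_of_alt_eq Γ hΓ), fun _ _ => rfl⟩

include hΓ in
/-- any map with the formula of (a) IS `Heisenberg.conjCoboundaryEquiv Γ`. [cite: MoeglinVignerasWaldspurger1987, Chap. 2 I.7] -/
theorem eq_conjCoboundaryEquiv_of_formula (Φ : Heisenberg B → Heisenberg B')
    (hΦ : ∀ (w : V) (t : R), Φ ⟨w, t⟩ = ⟨Γ w, t + ⅟(2 : R) * (B' (Γ w) (Γ w) - B w w)⟩) (h : Heisenberg B) :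
    Φ h = Heisenberg.conjCoboundaryEquiv Γ (sub_eq_sub_of_alt_eq Γ hΓ) h := by
  obtain ⟨w, t⟩ := h
  rw [hΦ]
  rfl

include hΓ in
/-- such a `Φ` is surjective. [cite: MoeglinVignerasWaldspurger1987, Chap. 2 I.7] -/
theorem surjective_of_formula (Φ : Heisenberg B → Heisenberg B')
    (hΦ : ∀ (w : V) (t : R), Φ ⟨w, t⟩ = ⟨Γ w, t + ⅟(2 : R) * (B' (Γ w) (Γ w) - B w w)⟩) :
    Function.Surjective Φ := fun h' =>
  ⟨(Heisenberg.conjCoboundaryEquiv Γ (sub_eq_sub_of_alt_eq Γ hΓ)).symm h', by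
    rw [eq_conjCoboundaryEquiv_of_formula Γ hΓ Φ hΦ, MulEquiv.apply_symm_apply]⟩

include hΓ in
/-- such a `Φ` is compatible with Weil's sections: `Φ (s(g)·h) = s'(Γ g Γ⁻¹)·(Φ h)`.
[cite: Weil1964, n° 5, pp. 150–151; MoeglinVignerasWaldspurger1987, Chap. 2 I.7] -/
theorem ofSymplectic_act_of_formula (Φ : Heisenberg B → Heisenberg B')
    (hΦ : ∀ (w : V) (t : R), Φ ⟨w, t⟩ = ⟨Γ w, t + ⅟(2 : R) * (B' (Γ w) (Γ w) - B w w)⟩)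
    (g : symplecticGroup B) (h : Heisenberg B) :
    Φ ((ofSymplectic B g).act h) =
      (ofSymplectic B' (symplecticConjOfAlt Γ (sub_eq_sub_of_alt_eq Γ hΓ) g)).act (Φ h) := by
  rw [eq_conjCoboundaryEquiv_of_formula Γ hΓ Φ hΦ, eq_conjCoboundaryEquiv_of_formula Γ hΓ Φ hΦ,
    Heisenberg.conjCoboundaryEquiv_ofSymplectic_act]

variable {k : Type*} [CommSemiring k] {S₁ : Type*} [AddCommMonoid S₁] [Module k S₁]
  {S₂ : Type*} [AddCommMonoid S₂] [Module k S₂]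
  {ρ₁ : Representation k (Heisenberg B) S₁} {ρ₂ : Representation k (Heisenberg B') S₂}

include hΓ in
/-- **(c) conjugating an implementer by an intertwiner**: for `Φ` with the formula of (a), an intertwiner
`Ψ (ρ₁(h) f) = ρ₂(Φ h) (Ψ f)`, `g ∈ Sp(V, A)` and `M` implementing `ofSymplectic g` on `ρ₁`, the operator
`Ψ M Ψ⁻¹ = Ψ.symm ≪≫ₗ M ≪≫ₗ Ψ` implements `ofSymplectic (Γ g Γ⁻¹)` on `ρ₂`.
[cite: MoeglinVignerasWaldspurger1987, Chap. 2 II.1 (A)] -/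
theorem implements_conj_of_symplectic (Φ : Heisenberg B → Heisenberg B')
    (hΦ : ∀ (w : V) (t : R), Φ ⟨w, t⟩ = ⟨Γ w, t + ⅟(2 : R) * (B' (Γ w) (Γ w) - B w w)⟩)
    (Ψ : S₁ ≃ₗ[k] S₂) (hΨ : ∀ (h : Heisenberg B) (f : S₁), Ψ (ρ₁ h f) = ρ₂ (Φ h) (Ψ f))
    {g : symplecticGroup B} {M : S₁ ≃ₗ[k] S₁} (hM : Implements ρ₁ (ofSymplectic B g) M) :
    Implements ρ₂ (ofSymplectic B' (symplecticConjOfAlt Γ (sub_eq_sub_of_alt_eq Γ hΓ) g)) (Ψ.symm ≪≫ₗ M ≪≫ₗ Ψ) :=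
  hM.intertwinerConj_of_surjective (surjective_of_formula Γ hΓ Φ hΦ) hΨ (ofSymplectic_act_of_formula Γ hΓ Φ hΦ g)

include hΓ in
/-- (c), uniqueness form: if moreover implementers of `ρ₂` are unique up to scalars and `M₂` implements
`ofSymplectic (Γ g Γ⁻¹)` on `ρ₂`, then `Ψ M = c · M₂ Ψ`. [cite: MoeglinVignerasWaldspurger1987, Chap. 2 II.1 (A)] -/
theorem exists_smul_conj_of_symplectic (Φ : Heisenberg B → Heisenberg B')
    (hΦ : ∀ (w : V) (t : R), Φ ⟨w, t⟩ = ⟨Γ w, t + ⅟(2 : R) * (B' (Γ w) (Γ w) - B w w)⟩)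
    (Ψ : S₁ ≃ₗ[k] S₂) (hΨ : ∀ (h : Heisenberg B) (f : S₁), Ψ (ρ₁ h f) = ρ₂ (Φ h) (Ψ f))
    (hU₂ : ∀ (g' : symplecticGroup B') (N N' : S₂ ≃ₗ[k] S₂), Implements ρ₂ (ofSymplectic B' g') N →
      Implements ρ₂ (ofSymplectic B' g') N' → ∃ c : kˣ, ∀ f : S₂, N' f = (c : k) • N f)
    {g : symplecticGroup B} {M : S₁ ≃ₗ[k] S₁} (hM : Implements ρ₁ (ofSymplectic B g) M) {M₂ : S₂ ≃ₗ[k] S₂}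
    (hM₂ : Implements ρ₂ (ofSymplectic B' (symplecticConjOfAlt Γ (sub_eq_sub_of_alt_eq Γ hΓ) g)) M₂) :
    ∃ c : kˣ, ∀ f : S₁, Ψ (M f) = (c : k) • M₂ (Ψ f) :=
  hM.exists_smul_of_intertwiner_of_surjective (surjective_of_formula Γ hΓ Φ hΦ) hΨ
    (ofSymplectic_act_of_formula Γ hΓ Φ hΦ g) (hU₂ _) hM₂

end General

/-! ## (b) the intertwiner `𝒮(F^n) ≃ 𝒮(F^ι)` for the Gram model `⟨·, T ·⟩` and the dot model -/

section Relabel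

variable {F : Type*} [Field F] {n ι : Type*} [Fintype n] [Fintype ι] (e : n ≃ ι)

/-- relabelling coordinates preserves the polar dot pairing. [folklore] -/
private theorem polar_dotProductBilin_relabel
    (r : ((n → F) × (n → F)) ≃ₗ[F] ((ι → F) × (ι → F)))
    (hr : ∀ w, r w = (w.1 ∘ e.symm, w.2 ∘ e.symm)) (v w : (n → F) × (n → F)) :
    polar (dotProductBilin F F (m := ι)) (r v) (r w) = polar (dotProductBilin F F (m := n)) v w := by
  rw [polar_apply, polar_apply, hr, hr, dotProductBilin_apply_apply, dotProductBilin_apply_apply]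
  exact comp_equiv_dotProduct_comp_equiv _ _ e.symm

variable [TopologicalSpace F] [IsTopologicalRing F] {ψ : AddChar F Circle}
  (hl : IsLocallyConstant (⇑ψ : F → Circle))
  (hbn : ∀ y : n → F, Continuous fun u : n → F => dotProductBilin F F u y)
  (hbι : ∀ y : ι → F, Continuous fun u : ι → F => dotProductBilin F F u y)

/-- **relabelling coordinates intertwines the dot models**: `(f ↦ f ∘ (· ∘ e))` carries `ρ_{⟨·,·⟩, n}(a)` to
`ρ_{⟨·,·⟩, ι}(relabel a)`. [cite: MoeglinVignerasWaldspurger1987, Chap. 2 I.4 Exemple (1)] -/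
private theorem compHomeomorphSB_schrodingerSB_relabel (hrel : (ι → F) ≃ₜ (n → F)) (hhrel : ∀ u, hrel u = u ∘ e)
    (r : ((n → F) × (n → F)) ≃ₗ[F] ((ι → F) × (ι → F))) (hr : ∀ w, r w = (w.1 ∘ e.symm, w.2 ∘ e.symm))
    (a : Heisenberg (polar (dotProductBilin F F (m := n)))) (f : SchwartzBruhat (n → F)) :
    compHomeomorphSB hrel (schrodingerSB (dotProductBilin F F (m := n)) ψ hl hbn a f) =
      schrodingerSB (dotProductBilin F F (m := ι)) ψ hl hbι
        (Heisenberg.mapEquiv r (polar_dotProductBilin_relabel e r hr) a) (compHomeomorphSB hrel f) := by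
  apply Subtype.ext
  funext u
  rw [coe_compHomeomorphSB, Function.comp_apply, schrodingerSB_apply, schrodingerSB_apply, Heisenberg.mapEquiv_t,
    Heisenberg.mapEquiv_v, hr, coe_compHomeomorphSB, Function.comp_apply, hhrel, hhrel, dotProductBilin_apply_apply,
    dotProductBilin_apply_apply]
  have h1 : (u ∘ e) ⬝ᵥ a.v.2 = u ⬝ᵥ (a.v.2 ∘ e.symm) := by
    rw [dotProduct_comm (u ∘ e), ← comp_equiv_symm_dotProduct a.v.2 u e, dotProduct_comm]
  have h2 : (u + a.v.1 ∘ e.symm) ∘ e = u ∘ e + a.v.1 := by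
    funext j
    simp only [Function.comp_apply, Pi.add_apply, Equiv.symm_apply_apply]
  rw [h1, h2]

end Relabel

section LocalField

variable {F : Type*} [Field F] [ValuativeRel F] [TopologicalSpace F] [IsNonarchimedeanLocalField F]
  [Invertible (2 : F)] {n ι : Type*} [Fintype n] [Fintype ι] [DecidableEq n]
  (T : Matrix n n F) (hT : IsUnit T.det) {ψ : AddChar F Circle} (hl : IsLocallyConstant (⇑ψ : F → Circle))
  (hb₁ : ∀ y : n → F, Continuous fun u : n → F => Matrix.toLinearMap₂' F T u y)
  (hb₂ : ∀ y : ι → F, Continuous fun u : ι → F => dotProductBilin F F u y)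
  (Γ : ((n → F) × (n → F)) ≃ₗ[F] ((ι → F) × (ι → F)))
  (hΓ : ∀ w w' : (n → F) × (n → F),
    alt (polar (dotProductBilin F F (m := ι))) (Γ w) (Γ w') = alt (polar (Matrix.toLinearMap₂' F T)) w w')

omit [ValuativeRel F] [TopologicalSpace F] [IsNonarchimedeanLocalField F] [Invertible (2 : F)] [DecidableEq n] in
/-- a linear isomorphism `F^n × F^n ≃ F^ι × F^ι` forces `|n| = |ι|`. [folklore] -/
private theorem card_eq_of_prodEquiv (Γ : ((n → F) × (n → F)) ≃ₗ[F] ((ι → F) × (ι → F))) :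
    Fintype.card n = Fintype.card ι := by
  have h := card_eq_of_linearEquiv F
    ((LinearEquiv.sumArrowLequivProdArrow n n F F).trans (Γ.trans (LinearEquiv.sumArrowLequivProdArrow ι ι F F).symm))
  rw [Fintype.card_sum, Fintype.card_sum] at h
  omega

include hT hΓ in
/-- **(b) the intertwiner of a symplectic change of coordinates**: for any `Φ` with the formula of (a) there is
`Ψ : 𝒮(F^n) ≃ₗ[ℂ] 𝒮(F^ι)` with `Ψ (ρ_T(h) f) = ρ_{⟨·,·⟩}(Φ h) (Ψ f)` (`det T` a unit, `ψ` continuous non-trivial,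
`2` invertible). [cite: MoeglinVignerasWaldspurger1987, Chap. 2 II.1 (A), II.2] -/
theorem exists_intertwiner_of_symplectic (hψ : ψ.IsContinuousNontrivial)
    (Φ : Heisenberg (polar (Matrix.toLinearMap₂' F T)) → Heisenberg (polar (dotProductBilin F F (m := ι))))
    (hΦ : ∀ (w : (n → F) × (n → F)) (t : F), Φ ⟨w, t⟩ =
      ⟨Γ w, t + ⅟(2 : F) * (polar (dotProductBilin F F (m := ι)) (Γ w) (Γ w) - polar (Matrix.toLinearMap₂' F T) w w)⟩) :
    ∃ Ψ : SchwartzBruhat (n → F) ≃ₗ[ℂ] SchwartzBruhat (ι → F),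
      ∀ (h : Heisenberg (polar (Matrix.toLinearMap₂' F T))) (f : SchwartzBruhat (n → F)),
        Ψ (schrodingerSB (Matrix.toLinearMap₂' F T) ψ hl hb₁ h f) =
          schrodingerSB (dotProductBilin F F (m := ι)) ψ hl hb₂ (Φ h) (Ψ f) := by
  classical
  -- `|n| = |ι|`: relabel the coordinates
  obtain ⟨e⟩ : Nonempty (n ≃ ι) := Fintype.card_eq.1 (card_eq_of_prodEquiv Γ)
  let r : ((n → F) × (n → F)) ≃ₗ[F] ((ι → F) × (ι → F)) :=
    (LinearEquiv.funCongrLeft F F e.symm).prodCongr (LinearEquiv.funCongrLeft F F e.symm)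
  have hr : ∀ w, r w = (w.1 ∘ e.symm, w.2 ∘ e.symm) := fun w => rfl
  let hrel : (ι → F) ≃ₜ (n → F) :=
    { toFun := fun u => u ∘ e
      invFun := fun x => x ∘ e.symm
      left_inv := fun u => funext fun i => by simp
      right_inv := fun x => funext fun j => by simp
      continuous_toFun := continuous_pi fun j => continuous_apply (e j)
      continuous_invFun := continuous_pi fun i => continuous_apply (e.symm i) }
  have hhrel : ∀ u, hrel u = u ∘ e := fun u => rfl
  -- `e₀ = r ∘ e_T` carries `polar β_T` to `polar ⟨·,·⟩` exactly
  let e₀ : ((n → F) × (n → F)) ≃ₗ[F] ((ι → F) × (ι → F)) := (gramProd T hT).trans r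
  have he₀ : ∀ v w, polar (dotProductBilin F F (m := ι)) (e₀ v) (e₀ w) = polar (Matrix.toLinearMap₂' F T) v w :=
    fun v w => by
      rw [LinearEquiv.trans_apply, LinearEquiv.trans_apply, polar_dotProductBilin_relabel e r hr,
        polar_dotProductBilin_gramProd]
  have he₀' : ∀ x y, polar (Matrix.toLinearMap₂' F T) (e₀.symm x) (e₀.symm y) =
      polar (dotProductBilin F F (m := ι)) x y := fun x y => by
    rw [← he₀, LinearEquiv.apply_symm_apply, LinearEquiv.apply_symm_apply]
  -- `g = e₀⁻¹ Γ ∈ Sp(A_T)`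
  have hg : (Γ.trans e₀.symm) ∈ symplecticGroup (polar (Matrix.toLinearMap₂' F T)) := by
    rw [mem_symplecticGroup]
    intro v w
    rw [LinearEquiv.trans_apply, LinearEquiv.trans_apply, he₀', he₀']
    exact sub_eq_sub_of_alt_eq Γ hΓ v w
  -- an implementer of `g` on `ρ_T`
  obtain ⟨M, hM⟩ := existsImplementer_schrodingerSB_gram T hT hl hb₁ hψ ⟨_, hg⟩
  refine ⟨M ≪≫ₗ compHomeomorphSB hrel, fun h f => ?_⟩
  -- `Φ h` is the transported, corrected element
  have hΦh : Φ h = Heisenberg.mapEquiv r (polar_dotProductBilin_relabel e r hr)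
      (Heisenberg.mapEquiv (gramProd T hT) (polar_dotProductBilin_gramProd T hT)
        ((ofSymplectic (polar (Matrix.toLinearMap₂' F T)) ⟨_, hg⟩).act h)) := by
    obtain ⟨w, t⟩ := h
    rw [hΦ]
    apply Heisenberg.ext
    · show Γ w = e₀ (e₀.symm (Γ w))
      rw [LinearEquiv.apply_symm_apply]
    · show t + ⅟(2 : F) * (polar (dotProductBilin F F (m := ι)) (Γ w) (Γ w) - polar (Matrix.toLinearMap₂' F T) w w) =
        t + ⅟(2 : F) * (polar (Matrix.toLinearMap₂' F T) (e₀.symm (Γ w)) (e₀.symm (Γ w)) -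
          polar (Matrix.toLinearMap₂' F T) w w)
      rw [he₀']
  rw [LinearEquiv.trans_apply, LinearEquiv.trans_apply, hM h f,
    schrodingerSB_gram_eq T hT hl continuous_dotProductBilin_left hb₁,
    compHomeomorphSB_schrodingerSB_relabel e hl continuous_dotProductBilin_left hb₂ hrel hhrel r hr, hΦh]

include hT hΓ in
/-- (b)+(c) packaged: an intertwiner `Ψ` exists, and then for every `g ∈ Sp(A_T)` and implementer `M` of `g` on `ρ_T`,
`Ψ M Ψ⁻¹` implements `Γ g Γ⁻¹` on the dot model. [cite: MoeglinVignerasWaldspurger1987, Chap. 2 II.1 (A)] -/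
theorem exists_intertwiner_implements_conj (hψ : ψ.IsContinuousNontrivial)
    (Φ : Heisenberg (polar (Matrix.toLinearMap₂' F T)) → Heisenberg (polar (dotProductBilin F F (m := ι))))
    (hΦ : ∀ (w : (n → F) × (n → F)) (t : F), Φ ⟨w, t⟩ =
      ⟨Γ w, t + ⅟(2 : F) * (polar (dotProductBilin F F (m := ι)) (Γ w) (Γ w) - polar (Matrix.toLinearMap₂' F T) w w)⟩) :
    ∃ Ψ : SchwartzBruhat (n → F) ≃ₗ[ℂ] SchwartzBruhat (ι → F),
      (∀ (h : Heisenberg (polar (Matrix.toLinearMap₂' F T))) (f : SchwartzBruhat (n → F)),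
        Ψ (schrodingerSB (Matrix.toLinearMap₂' F T) ψ hl hb₁ h f) =
          schrodingerSB (dotProductBilin F F (m := ι)) ψ hl hb₂ (Φ h) (Ψ f)) ∧
      ∀ (g : symplecticGroup (polar (Matrix.toLinearMap₂' F T)))
        (M : SchwartzBruhat (n → F) ≃ₗ[ℂ] SchwartzBruhat (n → F)),
        Implements (schrodingerSB (Matrix.toLinearMap₂' F T) ψ hl hb₁) (ofSymplectic _ g) M →
          Implements (schrodingerSB (dotProductBilin F F (m := ι)) ψ hl hb₂)
            (ofSymplectic _ (symplecticConjOfAlt Γ (sub_eq_sub_of_alt_eq Γ hΓ) g)) (Ψ.symm ≪≫ₗ M ≪≫ₗ Ψ) := by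
  obtain ⟨Ψ, hΨ⟩ := exists_intertwiner_of_symplectic T hT hl hb₁ hb₂ Γ hΓ hψ Φ hΦ
  exact ⟨Ψ, hΨ, fun g M hM => implements_conj_of_symplectic Γ hΓ Φ hΦ Ψ hΨ hM⟩

end LocalField

end Literature.RepresentationTheory.HeisenbergGroup

end
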